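import Mathlib
import HarnessLib
import Literature.Geometry.DiscreteGeometry.BondGraph
import Literature.Geometry.DiscreteGeometry.KissingPatterns
import Literature.Algebra.EuclideanLattices.FccBccLattices
import Summits.AtomisticToContinuum.Crystallization.Theorems.PricedLinkCensusSoftLayerPropagationStubMetricDet

/-!
# Small-cluster rigidity II: the solving lemma (Cramer) and robust independence in `ℝ³`
# (crux `SoftLayerPropagation`, line `Sketch`, stub `stub_metric`, registered sub-goal `metric_solve`)

Route `PricedLinkCensus`, crux `SoftLayerPropagation` (stmt-AtomisticToContinuum-14233), line `Sketch`.
The linear-algebra engine of the octahedron and bipyramid rigidity lemmas (sibling files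
`…StubMetricOcta`, `…StubMetricBipyramid`): an UNKNOWN vector of a small contact cluster (the offset
between the centres of two diagonals of an octahedron, the offset of the apex pair of a bipyramid
from the face centroid) is shown to be small by exhibiting three robustly independent KNOWN vectors
against which its inner products are small — all inner products being read off the squared edge
lengths by polarisation.

* `det3_smul_eq_sum_cross` — Cramer's identity `det(n₁,n₂,n₃) • v = Σₖ ⟪v,nₖ⟫ (nₗ × nₘ)` (coordinates);
* `norm_cross_le` — Lagrange: `‖a × b‖ ≤ ‖a‖ ‖b‖`;
* `norm_mul_abs_det3_le` — THE SOLVING LEMMA: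
  `‖v‖ · |det(n₁,n₂,n₃)| ≤ |⟪v,n₁⟫| ‖n₂‖‖n₃‖ + |⟪v,n₂⟫| ‖n₁‖‖n₃‖ + |⟪v,n₃⟫| ‖n₁‖‖n₂‖`;
* `det3_sq_ge_of_inner_le` — robust independence of a nearly orthogonal triple:
  `det² ≥ ‖n₁‖²‖n₂‖²‖n₃‖² − (‖n₁‖² + ‖n₂‖² + ‖n₃‖²) γ² − 2γ³` when `|⟪nᵢ,nⱼ⟫| ≤ γ`;
* `norm_sq_solve_le` — the two combined, division-free, with individual length floors `νₖ ≤ ‖nₖ‖`: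
  `‖v‖² (ν₁²ν₂²ν₃² − (Σνₖ²) γ² − 2γ³) ≤ (β₁ν₂ν₃ + β₂ν₁ν₃ + β₃ν₁ν₂)²` when `|⟪nᵢ,nⱼ⟫| ≤ γ`, `|⟪v,nₖ⟫| ≤ βₖ`;
* **`metric_solve`** (registered sub-goal) — the equal-floor case: `ν ≤ ‖nₖ‖` gives
  `‖v‖² (ν⁶ − 3γ²ν² − 2γ³) ≤ (β₁ + β₂ + β₃)² ν⁴` (for a nearly orthogonal triple of vectors of length
  `≥ ν` this is `‖v‖ ≲ (β₁+β₂+β₃)/ν`).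

All `[folklore]`; proofs are coordinate identities (`ring`) and explicit inequality chains.
-/

noncomputable section

namespace Summit.AtomisticToContinuum.Crystallization.Theorems

open Literature.Geometry.DiscreteGeometry

/-! ### Cramer's identity and the solving lemma -/

/-- **Cramer's identity in `ℝ³`**, coordinate form: `det(n₁,n₂,n₃) • v = Σₖ ⟪v,nₖ⟫ (nₗ × nₘ)`.
[folklore] -/
theorem det3_smul_eq_sum_cross (v n₁ n₂ n₃ : EuclideanSpace ℝ (Fin 3)) :
    Matrix.det ![WithLp.ofLp n₁, WithLp.ofLp n₂, WithLp.ofLp n₃] • v =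
      inner ℝ v n₁ • (WithLp.toLp 2 ![n₂ 1 * n₃ 2 - n₂ 2 * n₃ 1, n₂ 2 * n₃ 0 - n₂ 0 * n₃ 2,
          n₂ 0 * n₃ 1 - n₂ 1 * n₃ 0] : EuclideanSpace ℝ (Fin 3)) +
      inner ℝ v n₂ • (WithLp.toLp 2 ![n₃ 1 * n₁ 2 - n₃ 2 * n₁ 1, n₃ 2 * n₁ 0 - n₃ 0 * n₁ 2,
          n₃ 0 * n₁ 1 - n₃ 1 * n₁ 0] : EuclideanSpace ℝ (Fin 3)) +
      inner ℝ v n₃ • (WithLp.toLp 2 ![n₁ 1 * n₂ 2 - n₁ 2 * n₂ 1, n₁ 2 * n₂ 0 - n₁ 0 * n₂ 2,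
          n₁ 0 * n₂ 1 - n₁ 1 * n₂ 0] : EuclideanSpace ℝ (Fin 3)) := by
  ext i
  fin_cases i <;> simp [det3_eq, Literature.Algebra.EuclideanLattices.inner_fin_three] <;> ring

/-- **Lagrange's bound for the cross product**: `‖a × b‖ ≤ ‖a‖ ‖b‖` (coordinate form). [folklore] -/
theorem norm_cross_le (a b : EuclideanSpace ℝ (Fin 3)) :
    ‖(WithLp.toLp 2 ![a 1 * b 2 - a 2 * b 1, a 2 * b 0 - a 0 * b 2, a 0 * b 1 - a 1 * b 0] :
        EuclideanSpace ℝ (Fin 3))‖ ≤ ‖a‖ * ‖b‖ := by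
  have hsq : ‖(WithLp.toLp 2 ![a 1 * b 2 - a 2 * b 1, a 2 * b 0 - a 0 * b 2, a 0 * b 1 - a 1 * b 0] :
        EuclideanSpace ℝ (Fin 3))‖ ^ 2 ≤ (‖a‖ * ‖b‖) ^ 2 := by
    rw [mul_pow, Literature.Algebra.EuclideanLattices.norm_sq_fin_three,
      Literature.Algebra.EuclideanLattices.norm_sq_fin_three,
      Literature.Algebra.EuclideanLattices.norm_sq_fin_three]
    simp
    nlinarith [sq_nonneg (a 0 * b 0 + a 1 * b 1 + a 2 * b 2)]
  exact (pow_le_pow_iff_left₀ (norm_nonneg _) (by positivity) (by norm_num)).1 hsq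

/-- **The solving lemma.**  For any `v n₁ n₂ n₃ : ℝ³`,
`‖v‖ · |det(n₁,n₂,n₃)| ≤ |⟪v,n₁⟫| ‖n₂‖ ‖n₃‖ + |⟪v,n₂⟫| ‖n₁‖ ‖n₃‖ + |⟪v,n₃⟫| ‖n₁‖ ‖n₂‖`:
a vector with small inner products against three robustly independent vectors is small. [folklore] -/
theorem norm_mul_abs_det3_le (v n₁ n₂ n₃ : EuclideanSpace ℝ (Fin 3)) :
    ‖v‖ * |Matrix.det ![WithLp.ofLp n₁, WithLp.ofLp n₂, WithLp.ofLp n₃]| ≤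
      |inner ℝ v n₁| * (‖n₂‖ * ‖n₃‖) + |inner ℝ v n₂| * (‖n₁‖ * ‖n₃‖) +
        |inner ℝ v n₃| * (‖n₁‖ * ‖n₂‖) := by
  have h := congrArg (fun z : EuclideanSpace ℝ (Fin 3) => ‖z‖) (det3_smul_eq_sum_cross v n₁ n₂ n₃)
  simp only [norm_smul, Real.norm_eq_abs] at h
  rw [mul_comm, h]
  refine (norm_add₃_le).trans ?_
  simp only [norm_smul, Real.norm_eq_abs]
  gcongr
  · exact norm_cross_le n₂ n₃
  · calc _ ≤ ‖n₃‖ * ‖n₁‖ := norm_cross_le n₃ n₁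
      _ = ‖n₁‖ * ‖n₃‖ := mul_comm _ _
  · exact norm_cross_le n₁ n₂

/-! ### Robust independence and the combined, division-free solving bound -/

/-- **Robust independence of a nearly orthogonal triple**: if `|⟪nᵢ, nⱼ⟫| ≤ γ` for `i ≠ j` then
`det(n₁,n₂,n₃)² ≥ ‖n₁‖²‖n₂‖²‖n₃‖² − (‖n₁‖² + ‖n₂‖² + ‖n₃‖²) γ² − 2 γ³`. [folklore] -/
theorem det3_sq_ge_of_inner_le {γ : ℝ} (hγ : 0 ≤ γ) (n₁ n₂ n₃ : EuclideanSpace ℝ (Fin 3))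
    (h₁₂ : |inner ℝ n₁ n₂| ≤ γ) (h₁₃ : |inner ℝ n₁ n₃| ≤ γ) (h₂₃ : |inner ℝ n₂ n₃| ≤ γ) :
    ‖n₁‖ ^ 2 * ‖n₂‖ ^ 2 * ‖n₃‖ ^ 2 - (‖n₁‖ ^ 2 + ‖n₂‖ ^ 2 + ‖n₃‖ ^ 2) * γ ^ 2 - 2 * γ ^ 3 ≤
      Matrix.det ![WithLp.ofLp n₁, WithLp.ofLp n₂, WithLp.ofLp n₃] ^ 2 := by
  rw [det3_sq_eq_gram]
  have a₁₂ := abs_le.1 h₁₂; have a₁₃ := abs_le.1 h₁₃; have a₂₃ := abs_le.1 h₂₃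
  have s₁₂ : inner ℝ n₁ n₂ ^ 2 ≤ γ ^ 2 := sq_le_sq' a₁₂.1 a₁₂.2
  have s₁₃ : inner ℝ n₁ n₃ ^ 2 ≤ γ ^ 2 := sq_le_sq' a₁₃.1 a₁₃.2
  have s₂₃ : inner ℝ n₂ n₃ ^ 2 ≤ γ ^ 2 := sq_le_sq' a₂₃.1 a₂₃.2
  have p3 : |inner ℝ n₁ n₂ * inner ℝ n₁ n₃ * inner ℝ n₂ n₃| ≤ γ ^ 3 := by
    rw [abs_mul, abs_mul]
    calc _ ≤ γ * γ * γ :=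
          mul_le_mul (mul_le_mul h₁₂ h₁₃ (abs_nonneg _) hγ) h₂₃ (abs_nonneg _) (mul_nonneg hγ hγ)
      _ = γ ^ 3 := by ring
  have p3' := (abs_le.1 p3).1
  nlinarith [mul_le_mul_of_nonneg_left s₂₃ (sq_nonneg ‖n₁‖), mul_le_mul_of_nonneg_left s₁₃ (sq_nonneg ‖n₂‖),
    mul_le_mul_of_nonneg_left s₁₂ (sq_nonneg ‖n₃‖)]

/-- **The division-free solving bound with individual length floors.**  If `νₖ ≤ ‖nₖ‖` (`νₖ > 0`),
`|⟪nᵢ, nⱼ⟫| ≤ γ` and `|⟪v, nₖ⟫| ≤ βₖ`, then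
`‖v‖² (ν₁²ν₂²ν₃² − (ν₁² + ν₂² + ν₃²) γ² − 2γ³) ≤ (β₁ν₂ν₃ + β₂ν₁ν₃ + β₃ν₁ν₂)²`.
Proof: the solving lemma gives `ν₁ν₂ν₃ ‖v‖ |det| ≤ (β₁ν₂ν₃ + β₂ν₁ν₃ + β₃ν₁ν₂) ‖n₁‖‖n₂‖‖n₃‖`, robust
independence gives `det² ν₁²ν₂²ν₃² ≥ (‖n₁‖‖n₂‖‖n₃‖)² (ν₁²ν₂²ν₃² − (Σνₖ²) γ² − 2γ³)`. [folklore] -/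
theorem norm_sq_solve_le {ν₁ ν₂ ν₃ γ β₁ β₂ β₃ : ℝ} (hν₁ : 0 < ν₁) (hν₂ : 0 < ν₂) (hν₃ : 0 < ν₃)
    (hγ : 0 ≤ γ) (hβ₁ : 0 ≤ β₁) (hβ₂ : 0 ≤ β₂) (hβ₃ : 0 ≤ β₃)
    (v n₁ n₂ n₃ : EuclideanSpace ℝ (Fin 3)) (hn₁ : ν₁ ≤ ‖n₁‖) (hn₂ : ν₂ ≤ ‖n₂‖) (hn₃ : ν₃ ≤ ‖n₃‖)
    (h₁₂ : |inner ℝ n₁ n₂| ≤ γ) (h₁₃ : |inner ℝ n₁ n₃| ≤ γ) (h₂₃ : |inner ℝ n₂ n₃| ≤ γ)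
    (hv₁ : |inner ℝ v n₁| ≤ β₁) (hv₂ : |inner ℝ v n₂| ≤ β₂) (hv₃ : |inner ℝ v n₃| ≤ β₃) :
    ‖v‖ ^ 2 * (ν₁ ^ 2 * ν₂ ^ 2 * ν₃ ^ 2 - (ν₁ ^ 2 + ν₂ ^ 2 + ν₃ ^ 2) * γ ^ 2 - 2 * γ ^ 3) ≤
      (β₁ * ν₂ * ν₃ + β₂ * ν₁ * ν₃ + β₃ * ν₁ * ν₂) ^ 2 := by
  set N₁ := ‖n₁‖ with hN₁
  set N₂ := ‖n₂‖ with hN₂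
  set N₃ := ‖n₃‖ with hN₃
  set T := |Matrix.det ![WithLp.ofLp n₁, WithLp.ofLp n₂, WithLp.ofLp n₃]| with hT
  set P := N₁ * N₂ * N₃ with hP
  set μ := ν₁ * ν₂ * ν₃ with hμ
  set B := β₁ * ν₂ * ν₃ + β₂ * ν₁ * ν₃ + β₃ * ν₁ * ν₂ with hB
  have hN₁p : 0 < N₁ := hν₁.trans_le hn₁
  have hN₂p : 0 < N₂ := hν₂.trans_le hn₂
  have hN₃p : 0 < N₃ := hν₃.trans_le hn₃
  have hPp : 0 < P := by positivity
  have hμp : 0 < μ := by positivity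
  have hT0 : 0 ≤ T := abs_nonneg _
  have hv0 : 0 ≤ ‖v‖ := norm_nonneg _
  -- (1) the solving lemma with the `β` bounds
  have h1 : ‖v‖ * T ≤ β₁ * (N₂ * N₃) + β₂ * (N₁ * N₃) + β₃ * (N₁ * N₂) := by
    refine (norm_mul_abs_det3_le v n₁ n₂ n₃).trans ?_
    gcongr
  -- (2) `μ (β₁ N₂N₃ + β₂ N₁N₃ + β₃ N₁N₂) ≤ B P`
  have h2 : μ * (β₁ * (N₂ * N₃) + β₂ * (N₁ * N₃) + β₃ * (N₁ * N₂)) ≤ B * P := by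
    have e1 : ν₁ * (N₂ * N₃) ≤ P := by
      rw [hP]
      calc ν₁ * (N₂ * N₃) = ν₁ * N₂ * N₃ := by ring
        _ ≤ N₁ * N₂ * N₃ := by gcongr
    have e2 : ν₂ * (N₁ * N₃) ≤ P := by
      rw [hP]
      calc ν₂ * (N₁ * N₃) = N₁ * ν₂ * N₃ := by ring
        _ ≤ N₁ * N₂ * N₃ := by gcongr
    have e3 : ν₃ * (N₁ * N₂) ≤ P := by
      rw [hP]
      calc ν₃ * (N₁ * N₂) = N₁ * N₂ * ν₃ := by ring
        _ ≤ N₁ * N₂ * N₃ := by gcongr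
    have f1 := mul_le_mul_of_nonneg_left e1 (show 0 ≤ β₁ * ν₂ * ν₃ by positivity)
    have f2 := mul_le_mul_of_nonneg_left e2 (show 0 ≤ β₂ * ν₁ * ν₃ by positivity)
    have f3 := mul_le_mul_of_nonneg_left e3 (show 0 ≤ β₃ * ν₁ * ν₂ by positivity)
    rw [hμ, hB]
    linear_combination f1 + f2 + f3
  have h3 : μ * (‖v‖ * T) ≤ B * P := (mul_le_mul_of_nonneg_left h1 hμp.le).trans h2
  -- (3) robust independence, with `Σ Nₖ² μ² ≤ (Σ νₖ²) P²` and `μ² ≤ P²`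
  have h4 : P ^ 2 - (N₁ ^ 2 + N₂ ^ 2 + N₃ ^ 2) * γ ^ 2 - 2 * γ ^ 3 ≤ T ^ 2 := by
    rw [hT, sq_abs, hP]
    have key := det3_sq_ge_of_inner_le hγ n₁ n₂ n₃ h₁₂ h₁₃ h₂₃
    rw [← hN₁, ← hN₂, ← hN₃] at key
    linear_combination key
  have q₁ : ν₁ ^ 2 ≤ N₁ ^ 2 := pow_le_pow_left₀ hν₁.le hn₁ 2
  have q₂ : ν₂ ^ 2 ≤ N₂ ^ 2 := pow_le_pow_left₀ hν₂.le hn₂ 2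
  have q₃ : ν₃ ^ 2 ≤ N₃ ^ 2 := pow_le_pow_left₀ hν₃.le hn₃ 2
  have hμ2 : μ ^ 2 = ν₁ ^ 2 * ν₂ ^ 2 * ν₃ ^ 2 := by rw [hμ]; ring
  have hP2 : P ^ 2 = N₁ ^ 2 * N₂ ^ 2 * N₃ ^ 2 := by rw [hP]; ring
  have h5 : (N₁ ^ 2 + N₂ ^ 2 + N₃ ^ 2) * μ ^ 2 ≤ (ν₁ ^ 2 + ν₂ ^ 2 + ν₃ ^ 2) * P ^ 2 := by
    have f1 : N₁ ^ 2 * μ ^ 2 ≤ ν₁ ^ 2 * P ^ 2 := by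
      rw [hμ2, hP2]
      calc N₁ ^ 2 * (ν₁ ^ 2 * ν₂ ^ 2 * ν₃ ^ 2) = ν₁ ^ 2 * (N₁ ^ 2 * ν₂ ^ 2 * ν₃ ^ 2) := by ring
        _ ≤ ν₁ ^ 2 * (N₁ ^ 2 * N₂ ^ 2 * N₃ ^ 2) := by gcongr
    have f2 : N₂ ^ 2 * μ ^ 2 ≤ ν₂ ^ 2 * P ^ 2 := by
      rw [hμ2, hP2]
      calc N₂ ^ 2 * (ν₁ ^ 2 * ν₂ ^ 2 * ν₃ ^ 2) = ν₂ ^ 2 * (ν₁ ^ 2 * N₂ ^ 2 * ν₃ ^ 2) := by ring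
        _ ≤ ν₂ ^ 2 * (N₁ ^ 2 * N₂ ^ 2 * N₃ ^ 2) := by gcongr
    have f3 : N₃ ^ 2 * μ ^ 2 ≤ ν₃ ^ 2 * P ^ 2 := by
      rw [hμ2, hP2]
      calc N₃ ^ 2 * (ν₁ ^ 2 * ν₂ ^ 2 * ν₃ ^ 2) = ν₃ ^ 2 * (ν₁ ^ 2 * ν₂ ^ 2 * N₃ ^ 2) := by ring
        _ ≤ ν₃ ^ 2 * (N₁ ^ 2 * N₂ ^ 2 * N₃ ^ 2) := by gcongr
    linear_combination f1 + f2 + f3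
  have h6 : μ ^ 2 ≤ P ^ 2 := by
    rw [hμ2, hP2]; gcongr
  -- (4) `T² μ² ≥ P² (μ² − (Σν²) γ² − 2γ³)`
  have h7 : P ^ 2 * (μ ^ 2 - (ν₁ ^ 2 + ν₂ ^ 2 + ν₃ ^ 2) * γ ^ 2 - 2 * γ ^ 3) ≤ T ^ 2 * μ ^ 2 := by
    have hγ2 : 0 ≤ γ ^ 2 := sq_nonneg γ
    have hγ3 : 0 ≤ 2 * γ ^ 3 := by positivity
    have hμ20 : 0 ≤ μ ^ 2 := sq_nonneg μ
    have g1 := mul_le_mul_of_nonneg_right h4 hμ20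
    have g2 := mul_le_mul_of_nonneg_left h5 hγ2
    have g3 := mul_le_mul_of_nonneg_left h6 hγ3
    linear_combination g1 + g2 + g3
  -- (5) combine and divide by `P² > 0`
  have h8 : (μ * (‖v‖ * T)) ^ 2 ≤ (B * P) ^ 2 := pow_le_pow_left₀ (by positivity) h3 2
  have h9 : ‖v‖ ^ 2 * (P ^ 2 * (μ ^ 2 - (ν₁ ^ 2 + ν₂ ^ 2 + ν₃ ^ 2) * γ ^ 2 - 2 * γ ^ 3)) ≤
      B ^ 2 * P ^ 2 := by
    have g := mul_le_mul_of_nonneg_left h7 (sq_nonneg ‖v‖)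
    linear_combination g + h8
  have hP2p : 0 < P ^ 2 := by positivity
  have : ‖v‖ ^ 2 * (μ ^ 2 - (ν₁ ^ 2 + ν₂ ^ 2 + ν₃ ^ 2) * γ ^ 2 - 2 * γ ^ 3) * P ^ 2 ≤ B ^ 2 * P ^ 2 := by
    linear_combination h9
  have fin := le_of_mul_le_mul_right this hP2p
  rwa [hμ2] at fin

/-- **Registered sub-goal `metric_solve`: the division-free solving bound.**  If three vectors of
`ℝ³` have lengths `≥ ν > 0` and pairwise inner products `≤ γ` in absolute value, then every vector `v`
with `|⟪v, nₖ⟫| ≤ βₖ` satisfies `‖v‖² (ν⁶ − 3γ²ν² − 2γ³) ≤ (β₁ + β₂ + β₃)² ν⁴`; for a nearly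
orthogonal triple (`γ ≪ ν²`) this reads `‖v‖ ≤ (β₁+β₂+β₃)/(ν √(1 − 3γ²/ν⁴ − 2γ³/ν⁶))`
(the case `ν₁ = ν₂ = ν₃` of `norm_sq_solve_le`). [folklore] -/
theorem metric_solve : ∀ (ν γ β₁ β₂ β₃ : ℝ), 0 < ν → 0 ≤ γ → 0 ≤ β₁ → 0 ≤ β₂ → 0 ≤ β₃ →
    ∀ (v n₁ n₂ n₃ : EuclideanSpace ℝ (Fin 3)),
      ν ≤ ‖n₁‖ → ν ≤ ‖n₂‖ → ν ≤ ‖n₃‖ →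
      |inner ℝ n₁ n₂| ≤ γ → |inner ℝ n₁ n₃| ≤ γ → |inner ℝ n₂ n₃| ≤ γ →
      |inner ℝ v n₁| ≤ β₁ → |inner ℝ v n₂| ≤ β₂ → |inner ℝ v n₃| ≤ β₃ →
      ‖v‖ ^ 2 * (ν ^ 6 - 3 * γ ^ 2 * ν ^ 2 - 2 * γ ^ 3) ≤ (β₁ + β₂ + β₃) ^ 2 * ν ^ 4 := by
  intro ν γ β₁ β₂ β₃ hν hγ hβ₁ hβ₂ hβ₃ v n₁ n₂ n₃ hn₁ hn₂ hn₃ h₁₂ h₁₃ h₂₃ hv₁ hv₂ hv₃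
  have h := norm_sq_solve_le hν hν hν hγ hβ₁ hβ₂ hβ₃ v n₁ n₂ n₃ hn₁ hn₂ hn₃ h₁₂ h₁₃ h₂₃ hv₁ hv₂ hv₃
  have e1 : ν ^ 2 * ν ^ 2 * ν ^ 2 - (ν ^ 2 + ν ^ 2 + ν ^ 2) * γ ^ 2 - 2 * γ ^ 3 =
      ν ^ 6 - 3 * γ ^ 2 * ν ^ 2 - 2 * γ ^ 3 := by ring
  have e2 : (β₁ * ν * ν + β₂ * ν * ν + β₃ * ν * ν) ^ 2 = (β₁ + β₂ + β₃) ^ 2 * ν ^ 4 := by ring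
  rwa [e1, e2] at h

end Summit.AtomisticToContinuum.Crystallization.Theorems

end
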